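import Literature.NumberTheory.LFunctions.BurnolZetaSystemsHardy
import Literature.NumberTheory.LFunctions.BurnolSonineZeros
import Literature.NumberTheory.LFunctions.InvZetaPolynomialHeights
import Literature.NumberTheory.ConnesConsani2021.ArchimedeanSoninTrace
import HarnessLib

/-!
# Burnol's two systems: discharges and the logical assembly of Thms. 3.1–3.3 from §§4–6

LINE 1 — LABEL: RH-FREE (a discharge of one typed input and the propositional bookkeeping between the
typed statements of J.-F. Burnol, *Two complete and minimal systems associated with the zeros of the
Riemann zeta function*, JTNB 16 (2004) = arXiv:math/0203120v7; nothing here is worded as progress toward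
RH). bears_on: B-C/B-P (LADDER-RH COLUMN 6). WHAT THIS IS NOT: not a route, not a criterion; nothing here
bears on the truth of RH.

* `Burnol2004b_prop5_1_holds` — DISCHARGE of Prop. 5.1 ("from [Titchmarsh IX.7]") by the tree's
  unconditional Titchmarsh Theorem 9.7, `Literature.NumberTheory.LFunctions.exists_invZeta_height_seq`
  (`InvZetaPolynomialHeights.lean`).
* The printed assembly "The three theorems 3.1, 3.2, 3.3 are thus established" (TeX l.1377–1378): the
  constituent Props. 6.1, 6.2, 6.4–6.6, Thms. 6.3, 6.7, Cor. 5.3, Prop. 4.2 are COROLLARIES of the typed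
  Thms. 3.1–3.3 (`…_of_thm3_…`), and conversely Thm. 3.1 follows from Props. 6.1, 6.2, 6.4, Thm. 6.3 and
  the identification `Y_a^⊥ = P_a` (which Burnol refers to [Burnol2004, Thms. 6.24–6.25],
  TeX l.1294–1300), Thm. 3.2 from Thm. 6.7, Props. 6.5, 6.6 and the non-completeness of the `Z^a_{ρ,k}`
  for `a < 1`, Thm. 3.3 from Prop. 4.2, Thm. 6.3, Cor. 5.3 and the triangularity computation — pure
  logic over the typed statements, recorded so that a discharge of either side transports.

* DEDUP BRIDGE to the Connes–Consani corpus, PROVED: Burnol's Sonine space `K_a` (`sonineK a`, typed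
  with the printed one-sided conditions "on `(0,a)`") and Connes–Consani's Sonin space `S(α, β)`
  (`Literature.NumberTheory.ConnesConsani2021.soninSpace`, Def. 4.4 of CC 2021: even, zero a.e. on
  `[−α, α]`, `𝓕` zero a.e. on `[−β, β]`) are the SAME subset of `L²(ℝ)` for `α = β = a`:
  `sonineK_eq_soninSpace : sonineK a = soninSpace a a` (with the two inclusions under their own names).
  The one non-definitional input is that the `L²` Fourier–Plancherel transform of an even class is even
  (`fourierL2_even`), obtained from `𝓕(f_T) = (𝓕 f)_T` on `L²(ℝ)` (`fourierL2_comp_neg`, by Schwartz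
  density from Mathlib's `Real.fourier_comp_linearIsometry`).

* `HasCompletedMellinEntire.eq` / `hasCompletedMellinEntire_completedMellinEntire`: uniqueness and the
  defining property of the entire completed Mellin transform `𝒢_f` of `BurnolSonineZeros.lean` (§7).

No new definitions, no new named facts.
-/

noncomputable section

open MeasureTheory Complex Filter Set
open scoped ComplexConjugate FourierTransform Topology ENNReal

namespace Literature.NumberTheory.LFunctions

/-! ## Discharge of Prop. 5.1 (Titchmarsh's Theorem 9.7) -/

/-- **Prop. 5.1 holds**: Titchmarsh's Theorem 9.7 in Burnol's sequence form, proved unconditionally in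
`InvZetaPolynomialHeights.lean`. [cite: Titchmarsh1986, Thm. 9.7; Burnol2004b, Prop. 5.1 (arXiv:math/0203120v7 p. 11)] -/
theorem Burnol2004b_prop5_1_holds : Burnol2004b_prop5_1 :=
  exists_invZeta_height_seq

/-! ## The entire completed Mellin transform `𝒢_f`: uniqueness -/

/-- RH-FREE (uniqueness: two entire continuations of `Γ_ℝ f̂` coincide — identity theorem on `ℂ`). This
makes `completedMellinEntire` canonical. [cite: Burnol2004b, Thm. 2.1 (arXiv:math/0203120v7 p. 5, TeX l.437–443)] -/
theorem HasCompletedMellinEntire.eq {f : ℝ → ℂ} {M₁ M₂ : ℂ → ℂ} (h₁ : HasCompletedMellinEntire f M₁)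
    (h₂ : HasCompletedMellinEntire f M₂) : M₁ = M₂ := by
  have ha₁ : AnalyticOnNhd ℂ M₁ univ := h₁.1.differentiableOn.analyticOnNhd isOpen_univ
  have ha₂ : AnalyticOnNhd ℂ M₂ univ := h₂.1.differentiableOn.analyticOnNhd isOpen_univ
  have hstrip : IsOpen {s : ℂ | 1 / 2 < s.re ∧ s.re < 1} :=
    (isOpen_lt continuous_const Complex.continuous_re).inter
      (isOpen_lt Complex.continuous_re continuous_const)
  have hmem : (3 / 4 : ℂ) ∈ {s : ℂ | 1 / 2 < s.re ∧ s.re < 1} := by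
    simp only [mem_setOf_eq]; norm_num
  have hev : M₁ =ᶠ[𝓝 (3 / 4 : ℂ)] M₂ := by
    filter_upwards [hstrip.mem_nhds hmem] with s hs
    rw [h₁.2 s hs.1 hs.2, h₂.2 s hs.1 hs.2]
  have h := ha₁.eqOn_of_preconnected_of_eventuallyEq ha₂ isPreconnected_univ (mem_univ _) hev
  exact funext fun s ↦ h (mem_univ s)

/-- RH-FREE (the defining property of `completedMellinEntire` when an entire continuation exists).
[cite: Burnol2004b, Thm. 2.1 (arXiv:math/0203120v7 p. 5, TeX l.437–443)] -/
theorem hasCompletedMellinEntire_completedMellinEntire {f : ℝ → ℂ}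
    (h : ∃ M, HasCompletedMellinEntire f M) : HasCompletedMellinEntire f (completedMellinEntire f) :=
  Classical.epsilon_spec h

/-- RH-FREE (consistency of the two continuations off `s = 1`): if `f̂` has an entire completed continuation
`M` (Thm. 2.1), then `G := M / Γ_ℝ` (with `1/Γ_ℝ` entire) is a continuation of `f̂` to `ℂ ∖ {1}` in the
sense of `HasRightMellinContinuation`, provided `1/Γ_ℝ` is differentiable — recorded in the weaker form that
the strip values agree: `M(s) = Γ_ℝ(s) · f̂(s) = Γ_ℝ(s) · G(s)` for every continuation `G` and `s` in the
strip. [cite: Burnol2004b, Thm. 2.1 / Prop. 2.2 (arXiv:math/0203120v7 p. 5, TeX l.437–469)] -/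
theorem HasCompletedMellinEntire.eq_mul_of_hasRightMellinContinuation {f : ℝ → ℂ} {M G : ℂ → ℂ}
    (hM : HasCompletedMellinEntire f M) (hG : HasRightMellinContinuation f G) {s : ℂ}
    (h1 : 1 / 2 < s.re) (h2 : s.re < 1) : M s = Gammaℝ s * G s := by
  rw [hM.2 s h1 h2, hG.2 s h1 h2]

/-! ## Evenness of the `L²` Fourier transform and the bridge `K_a = S(a, a)` -/

/-- Reflection `x ↦ −x` preserves Lebesgue measure (private plumbing). [folklore] -/
private theorem measurePreserving_neg_real :
    MeasurePreserving (fun x : ℝ ↦ -x) (volume : Measure ℝ) volume :=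
  Measure.measurePreserving_neg (volume : Measure ℝ)

/-- The transposed class `f_T` is a.e. `x ↦ f(−x)` (private plumbing). [folklore] -/
private theorem coeFn_reflect_neg (f : Lp ℂ 2 (volume : Measure ℝ)) :
    (Lp.compMeasurePreservingₗᵢ ℂ (fun x : ℝ ↦ -x) measurePreserving_neg_real f : ℝ → ℂ) =ᵐ[volume]
      fun x ↦ f (-x) :=
  Lp.coeFn_compMeasurePreserving f measurePreserving_neg_real

/-- Pull-back of an a.e. equality along `x ↦ −x` (private plumbing). [folklore] -/
private theorem ae_eq_comp_neg' {f g : ℝ → ℂ} (h : f =ᵐ[volume] g) :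
    (fun x : ℝ ↦ f (-x)) =ᵐ[volume] fun x : ℝ ↦ g (-x) :=
  measurePreserving_neg_real.quasiMeasurePreserving.ae_eq_comp h

/-- Pull-back of an a.e. property along `x ↦ −x` (private plumbing). [folklore] -/
private theorem ae_comp_neg' {p : ℝ → Prop} (h : ∀ᵐ x : ℝ, p x) : ∀ᵐ x : ℝ, p (-x) :=
  measurePreserving_neg_real.quasiMeasurePreserving.ae h

/-- **The `L²` Fourier–Plancherel transform commutes with transposition**: `𝓕(f_T) = (𝓕 f)_T` on
`L²(ℝ)`, `f_T(x) = f(−x)` (Champeney's transposition rule `f_T ↔ F_T`, valid for `L²` pairs; proof: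
Schwartz density + Mathlib's `Real.fourier_comp_linearIsometry`).
[cite: Champeney1987, Thm. 6.1 eq. (6.7) (p. 54)] -/
theorem fourierL2_comp_neg (f : Lp ℂ 2 (volume : Measure ℝ)) :
    (𝓕 (Lp.compMeasurePreservingₗᵢ ℂ (fun x : ℝ ↦ -x) measurePreserving_neg_real f) :
        Lp ℂ 2 (volume : Measure ℝ)) =
      Lp.compMeasurePreservingₗᵢ ℂ (fun x : ℝ ↦ -x) measurePreserving_neg_real
        (𝓕 f : Lp ℂ 2 (volume : Measure ℝ)) := by
  have hd := SchwartzMap.denseRange_toLpCLM (E := ℝ) (F := ℂ) (p := 2) (μ := volume) ENNReal.ofNat_ne_top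
  refine hd.induction_on (p := fun g : Lp ℂ 2 (volume : Measure ℝ) ↦
    (𝓕 (Lp.compMeasurePreservingₗᵢ ℂ (fun x : ℝ ↦ -x) measurePreserving_neg_real g) :
        Lp ℂ 2 (volume : Measure ℝ)) =
      Lp.compMeasurePreservingₗᵢ ℂ (fun x : ℝ ↦ -x) measurePreserving_neg_real
        (𝓕 g : Lp ℂ 2 (volume : Measure ℝ))) f ?_ ?_
  · have hF : Continuous (fun g : Lp ℂ 2 (volume : Measure ℝ) ↦ (𝓕 g : Lp ℂ 2 (volume : Measure ℝ))) :=
      (Lp.fourierTransformₗᵢ ℝ ℂ).continuous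
    have hR : Continuous (Lp.compMeasurePreservingₗᵢ ℂ (fun x : ℝ ↦ -x) measurePreserving_neg_real :
        Lp ℂ 2 (volume : Measure ℝ) → Lp ℂ 2 (volume : Measure ℝ)) :=
      (Lp.compMeasurePreservingₗᵢ ℂ (fun x : ℝ ↦ -x) measurePreserving_neg_real).continuous
    apply isClosed_eq
    · exact hF.comp hR
    · exact hR.comp hF
  · intro φ
    -- the transposed Schwartz function
    set ψ : SchwartzMap ℝ ℂ := SchwartzMap.compCLMOfContinuousLinearEquiv ℂ (ContinuousLinearEquiv.neg ℝ) φ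
      with hψ
    have hψapp : ∀ x : ℝ, ψ x = φ (-x) := fun x ↦ rfl
    -- `reflect (φ.toLp) = ψ.toLp`
    have h1 : Lp.compMeasurePreservingₗᵢ ℂ (fun x : ℝ ↦ -x) measurePreserving_neg_real
        (SchwartzMap.toLpCLM ℝ ℂ 2 volume φ) = ψ.toLp 2 := by
      rw [SchwartzMap.toLpCLM_apply]
      apply Lp.ext
      filter_upwards [coeFn_reflect_neg (φ.toLp 2), ae_eq_comp_neg' (SchwartzMap.coeFn_toLp φ 2),
        SchwartzMap.coeFn_toLp ψ 2] with x hx hφ hψx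
      rw [hx, hφ, hψx, hψapp]
    -- `𝓕 ψ = (𝓕 φ) ∘ neg` as functions
    have h2 : ∀ x : ℝ, (𝓕 ψ : SchwartzMap ℝ ℂ) x = (𝓕 φ : SchwartzMap ℝ ℂ) (-x) := by
      intro x
      have e1 : ((𝓕 ψ : SchwartzMap ℝ ℂ) : ℝ → ℂ) = 𝓕 (ψ : ℝ → ℂ) := SchwartzMap.fourier_coe ψ
      have e2 : ((𝓕 φ : SchwartzMap ℝ ℂ) : ℝ → ℂ) = 𝓕 (φ : ℝ → ℂ) := SchwartzMap.fourier_coe φ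
      rw [e1, e2]
      have hcomp : (ψ : ℝ → ℂ) = (φ : ℝ → ℂ) ∘ (LinearIsometryEquiv.neg ℝ (E := ℝ)) := by
        funext y; simp [hψapp]
      rw [hcomp, Real.fourier_comp_linearIsometry]
      simp
    rw [h1, SchwartzMap.toLp_fourier_eq, SchwartzMap.toLpCLM_apply, SchwartzMap.toLp_fourier_eq]
    apply Lp.ext
    filter_upwards [SchwartzMap.coeFn_toLp (𝓕 ψ : SchwartzMap ℝ ℂ) 2,
      coeFn_reflect_neg ((𝓕 φ : SchwartzMap ℝ ℂ).toLp 2),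
      ae_eq_comp_neg' (SchwartzMap.coeFn_toLp (𝓕 φ : SchwartzMap ℝ ℂ) 2)] with x h3 h4 h5
    rw [h3, h4, h5, h2]

/-- **The `L²` Fourier transform of an even class is even** ("their Fourier (cosine) transforms": for even
`f ∈ L²(ℝ)` the Fourier transform is the cosine transform, in particular even).
[cite: Burnol2004b, §2 (arXiv:math/0203120v7 p. 5, TeX l.426–434); Champeney1987, Thm. 6.1 eq. (6.7) (p. 54)] -/
theorem fourierL2_even {f : Lp ℂ 2 (volume : Measure ℝ)} (hf : ∀ᵐ x : ℝ, f (-x) = f x) :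
    ∀ᵐ x : ℝ, (𝓕 f : Lp ℂ 2 (volume : Measure ℝ)) (-x) = (𝓕 f : Lp ℂ 2 (volume : Measure ℝ)) x := by
  have h1 : Lp.compMeasurePreservingₗᵢ ℂ (fun x : ℝ ↦ -x) measurePreserving_neg_real f = f := by
    apply Lp.ext
    filter_upwards [coeFn_reflect_neg f, hf] with x hx h
    rw [hx, h]
  have h2 := fourierL2_comp_neg f
  rw [h1] at h2
  -- `𝓕 f = (𝓕 f)_T`, hence a.e. `(𝓕 f)(-x) = (𝓕 f)(x)`
  have h3 := coeFn_reflect_neg (𝓕 f : Lp ℂ 2 (volume : Measure ℝ))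
  rw [← h2] at h3
  filter_upwards [h3] with x hx
  exact hx.symm

/-- For an a.e. even function, vanishing a.e. on `(0,a)` is vanishing a.e. on `[−a, a]` (the three points
`−a, 0, a` are Lebesgue-null; private plumbing). [folklore] -/
private theorem ae_zero_Icc_of_Ioo {g : ℝ → ℂ} {a : ℝ} (heven : ∀ᵐ x : ℝ, g (-x) = g x)
    (hz : ∀ᵐ x : ℝ, x ∈ Set.Ioo 0 a → g x = 0) : ∀ᵐ x : ℝ, x ∈ Set.Icc (-a) a → g x = 0 := by
  have hnull : ∀ᵐ x : ℝ, x ∉ ({-a, 0, a} : Set ℝ) :=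
    measure_eq_zero_iff_ae_notMem.1 ((Set.toFinite _).measure_zero volume)
  filter_upwards [heven, hz, ae_comp_neg' (p := fun x ↦ x ∈ Set.Ioo 0 a → g x = 0) hz, hnull]
    with x he h1 h2 hx hxI
  simp only [Set.mem_insert_iff, Set.mem_singleton_iff, not_or] at hx
  rcases lt_or_gt_of_ne hx.2.1 with hneg | hpos
  · rw [← he]
    exact h2 ⟨by linarith, by linarith [hxI.1, lt_of_le_of_ne hxI.1 (Ne.symm hx.1)]⟩
  · exact h1 ⟨hpos, lt_of_le_of_ne hxI.2 hx.2.2⟩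

/-- **DEDUP BRIDGE — Burnol's `K_a` IS Connes–Consani's `S(a, a)`** (as subsets of `L²(ℝ)`):
`sonineK a = soninSpace a a`. Burnol / de Branges: "The Sonine space `K_a` consists of the functions in `K`
which are vanishing identically, as well as their Fourier (cosine) transforms, in `(0,a)`" (`K` = the even
square-integrable functions); Connes–Consani (`Literature.NumberTheory.ConnesConsani2021.soninSpace`,
CC 2021 Def. 4.4): even, zero a.e. on `[−α, α]`, `𝓕` zero a.e. on `[−β, β]`. For even `f` the Fourier
transform is even (`fourierL2_even`), so the one-sided and the symmetric conditions agree up to the null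
set `{−a, 0, a}`. [cite: Burnol2004b, §2 (arXiv:math/0203120v7 p. 5, TeX l.426–434)] -/
theorem sonineK_eq_soninSpace (a : ℝ) :
    sonineK a =
      (Literature.NumberTheory.ConnesConsani2021.soninSpace a a : Set (Lp ℂ 2 (volume : Measure ℝ))) := by
  apply Set.Subset.antisymm
  · rintro f ⟨h0, h1, h2⟩
    exact ⟨h0, ae_zero_Icc_of_Ioo h0 h1, ae_zero_Icc_of_Ioo (fourierL2_even h0) h2⟩
  · rintro f ⟨h1, h2, h3⟩
    refine ⟨h1, ?_, ?_⟩
    · filter_upwards [h2] with x hx hxI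
      exact hx ⟨by linarith [hxI.1, hxI.2], hxI.2.le⟩
    · filter_upwards [h3] with p hp hpI
      exact hp ⟨by linarith [hpI.1, hpI.2], hpI.2.le⟩

/-- `S(a, a) ⊆ K_a` (the inclusion of Connes–Consani's Sonin space in Burnol's Sonine space; a corollary of
`sonineK_eq_soninSpace`, kept under its own name). [cite: Burnol2004b, §2 (arXiv:math/0203120v7 p. 5, TeX l.426–434)] -/
theorem soninSpace_subset_sonineK (a : ℝ) :
    (Literature.NumberTheory.ConnesConsani2021.soninSpace a a : Set (Lp ℂ 2 (volume : Measure ℝ))) ⊆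
      sonineK a :=
  (sonineK_eq_soninSpace a).symm.subset

/-- `K_a ⊆ S(a, a)` (Burnol's Sonine space inside Connes–Consani's Sonin space).
[cite: Burnol2004b, §2 (arXiv:math/0203120v7 p. 5, TeX l.426–434)] -/
theorem sonineK_subset_soninSpace (a : ℝ) :
    sonineK a ⊆
      (Literature.NumberTheory.ConnesConsani2021.soninSpace a a : Set (Lp ℂ 2 (volume : Measure ℝ))) :=
  (sonineK_eq_soninSpace a).subset

/-! ## §6, §5, §4 constituents as corollaries of Thms. 3.1–3.3 -/

/-- Prop. 6.1 from Thm. 3.1 (the `a ≥ 1` half of "complete iff `a ≥ 1`").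
[cite: Burnol2004b, Prop. 6.1 and Thm. 3.1 (arXiv:math/0203120v7 pp. 6, 15)] -/
theorem Burnol2004b_prop6_1_of_thm3_1 (h : Burnol2004b_thm3_1) : Burnol2004b_prop6_1 := by
  intro a ha
  exact ((h a (by linarith)).2.1).2 ha

/-- Prop. 6.2 from Thm. 3.1 (`a > 1`: not minimal, complete after finite omissions).
[cite: Burnol2004b, Prop. 6.2 and Thm. 3.1 (arXiv:math/0203120v7 pp. 6, 15)] -/
theorem Burnol2004b_prop6_2_of_thm3_1 (h : Burnol2004b_thm3_1) : Burnol2004b_prop6_2 := by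
  intro a ha
  obtain ⟨hmin, -, -, homit⟩ := h a (by linarith)
  exact ⟨fun hm ↦ by have := hmin.1 hm; linarith, homit ha⟩

/-- Prop. 6.4 from Thm. 3.1 (`a < 1`: minimal, not complete).
[cite: Burnol2004b, Prop. 6.4 and Thm. 3.1 (arXiv:math/0203120v7 pp. 6, 16)] -/
theorem Burnol2004b_prop6_4_of_thm3_1 (h : Burnol2004b_thm3_1) : Burnol2004b_prop6_4 := by
  intro a ha0 ha1
  obtain ⟨hmin, hcomp, -, -⟩ := h a ha0
  exact ⟨hmin.2 ha1.le, fun hc ↦ by have := hcomp.1 hc; linarith⟩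

/-- Thm. 6.3 from Thms. 3.1 (at `a = 1`) and 3.3.
[cite: Burnol2004b, Thm. 6.3, Thms. 3.1 and 3.3 (arXiv:math/0203120v7 pp. 6–7, 16)] -/
theorem Burnol2004b_thm6_3_of_thm3_1_thm3_3 (h1 : Burnol2004b_thm3_1) (h3 : Burnol2004b_thm3_3) :
    Burnol2004b_thm6_3 := by
  obtain ⟨hmin, hcomp, -, -⟩ := h1 1 one_pos
  exact ⟨⟨hmin.2 le_rfl, hcomp.2 le_rfl⟩, h3.2.1, h3.2.2.1⟩

/-- Thm. 6.7 from Thm. 3.2 (`a < 1`: the `Z^a_{ρ,k}` are minimal).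
[cite: Burnol2004b, Thm. 6.7 and Thm. 3.2 (arXiv:math/0203120v7 pp. 6, 17)] -/
theorem Burnol2004b_thm6_7_of_thm3_2 (h : Burnol2004b_thm3_2) : Burnol2004b_thm6_7 :=
  fun a ha0 ha1 ↦ ((h a ha0).1 ha1).1

/-- Prop. 6.5 from Thm. 3.2 (at `a = 1`).
[cite: Burnol2004b, Prop. 6.5 and Thm. 3.2 (arXiv:math/0203120v7 pp. 6, 16)] -/
theorem Burnol2004b_prop6_5_of_thm3_2 (h : Burnol2004b_thm3_2) : Burnol2004b_prop6_5 := by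
  obtain ⟨-, h1, -⟩ := h 1 one_pos
  obtain ⟨hnm, hpq⟩ := h1 rfl
  exact ⟨hnm, fun p q hpq' ↦ ⟨(hpq p q hpq').2, (hpq p q hpq').1⟩⟩

/-- Prop. 6.6 from Thm. 3.2 (`a > 1`).
[cite: Burnol2004b, Prop. 6.6 and Thm. 3.2 (arXiv:math/0203120v7 pp. 6, 17)] -/
theorem Burnol2004b_prop6_6_of_thm3_2 (h : Burnol2004b_thm3_2) : Burnol2004b_prop6_6 :=
  fun a ha S ↦ (h a (by linarith)).2.2 ha S

/-- Cor. 5.3 is the completeness clause of Thm. 3.3.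
[cite: Burnol2004b, Cor. 5.3 and Thm. 3.3 (arXiv:math/0203120v7 pp. 7, 14)] -/
theorem Burnol2004b_cor5_3_of_thm3_3 (h : Burnol2004b_thm3_3) : Burnol2004b_cor5_3 :=
  h.2.2.1

/-- Prop. 4.2 is the membership clause of Thm. 3.3 (re-indexed: `l = k + 1`, `1 ≤ l ≤ m_ρ`).
[cite: Burnol2004b, Prop. 4.2 and Thm. 3.3 (arXiv:math/0203120v7 pp. 7–8)] -/
theorem Burnol2004b_prop4_2_of_thm3_3 (h : Burnol2004b_thm3_3) : Burnol2004b_prop4_2 := by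
  intro ρ hρ l hl1 hlm
  obtain ⟨k, rfl⟩ : ∃ k : ℕ, l = k + 1 := ⟨l - 1, by omega⟩
  have hk : ((k : ℕ) : ℤ) < riemannZetaZeroOrder ρ := by push_cast at hlm; omega
  exact h.1 ⟨(ρ, k), hρ, hk⟩

/-- Conversely, the membership clause of Thm. 3.3 from Prop. 4.2.
[cite: Burnol2004b, Prop. 4.2 and Thm. 3.3 (arXiv:math/0203120v7 pp. 7–8)] -/
theorem Burnol2004b_thm3_3_mem_of_prop4_2 (h : Burnol2004b_prop4_2) :
    ∀ p : ZetaZeroIndex, ∃ v, IsZetaQuotientVector p.1.1 (p.1.2 + 1) v := by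
  intro p
  refine h p.1.1 p.2.1 (p.1.2 + 1) (by omega) ?_
  have := p.2.2
  push_cast
  omega

/-! ## The assembly of Thms. 3.1, 3.2, 3.3 from their constituents -/

/-- **Thm. 3.1 assembled** ("With this the proof of 3.1 is completed, with the exception of the
identification of the co-Poisson space as the perpendicular complement …; we refer the reader to
[Burnol2004, Thms. 6.24, 6.25]", TeX l.1294–1300): from Props. 6.1, 6.2, 6.4, Thm. 6.3 and that
identification. [cite: Burnol2004b, §6 (arXiv:math/0203120v7 pp. 15–16, TeX l.1192–1300)] -/
theorem Burnol2004b_thm3_1_of (h61 : Burnol2004b_prop6_1) (h62 : Burnol2004b_prop6_2)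
    (h63 : Burnol2004b_thm6_3) (h64 : Burnol2004b_prop6_4)
    (hperp : ∀ a : ℝ, 0 < a → a < 1 →
      {f | f ∈ sonineL a ∧ ∀ p : ZetaZeroIndex, inner ℂ (burnolYSystem a p) f = 0} = coPoissonP a) :
    Burnol2004b_thm3_1 := by
  intro a ha
  refine ⟨⟨fun hmin ↦ ?_, fun hle ↦ ?_⟩, ⟨fun hc ↦ ?_, fun hge ↦ h61 a hge⟩, hperp a ha,
    fun hgt ↦ (h62 a hgt).2⟩
  · by_contra hgt
    exact (h62 a (lt_of_not_ge hgt)).1 hmin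
  · rcases hle.lt_or_eq with hlt | heq
    · exact (h64 a ha hlt).1
    · rw [heq]; exact h63.1.1
  · by_contra hlt
    exact (h64 a ha (lt_of_not_ge hlt)).2 hc

/-- **Thm. 3.2 assembled** from Thm. 6.7, the non-completeness of the `Z^a_{ρ,k}` for `a < 1` (the
co-Poisson subspace `W′_a = P_a ∩ K_a`, TeX l.500–504; a hypothesis here), Prop. 6.5 and Prop. 6.6.
[cite: Burnol2004b, §6 (arXiv:math/0203120v7 pp. 16–17, TeX l.1303–1378)] -/
theorem Burnol2004b_thm3_2_of (h67 : Burnol2004b_thm6_7)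
    (hnc : ∀ a : ℝ, 0 < a → a < 1 → ¬ IsCompleteSystemIn (sonineK a) (burnolZSystem a))
    (h65 : Burnol2004b_prop6_5) (h66 : Burnol2004b_prop6_6) : Burnol2004b_thm3_2 := by
  intro a ha
  refine ⟨fun h1 ↦ ⟨h67 a ha h1, hnc a ha h1⟩, fun h1 ↦ ⟨h65.1, fun p q hpq ↦ ?_⟩,
    fun h1 S ↦ h66 a h1 S⟩
  exact ⟨(h65.2 p q hpq).2, (h65.2 p q hpq).1⟩

/-- **Thm. 3.3 assembled** from Prop. 4.2 (membership), Thm. 6.3 (minimality and completeness; Cor. 5.3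
is its completeness half) and the triangularity of the pairings `[ζ(s)/(s−ρ)^l, Y¹_{ρ′,k}]` (a
hypothesis here, TeX l.1272–1277). [cite: Burnol2004b, §6 (arXiv:math/0203120v7 p. 16, TeX l.1259–1280)] -/
theorem Burnol2004b_thm3_3_of (h42 : Burnol2004b_prop4_2) (h63 : Burnol2004b_thm6_3)
    (hoff : ∀ p q : ZetaZeroIndex, q.1.1 ≠ p.1.1 →
      ∫ t in Set.Ioi (0 : ℝ), zetaQuotientSystem p t * burnolYSystem 1 q t = 0)
    (hlow : ∀ p q : ZetaZeroIndex, q.1.1 = p.1.1 →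
      (q.1.2 : ℤ) + p.1.2 + 1 < riemannZetaZeroOrder p.1.1 →
      ∫ t in Set.Ioi (0 : ℝ), zetaQuotientSystem p t * burnolYSystem 1 q t = 0)
    (hdiag : ∀ p q : ZetaZeroIndex, q.1.1 = p.1.1 →
      (q.1.2 : ℤ) + p.1.2 + 1 = riemannZetaZeroOrder p.1.1 →
      ∫ t in Set.Ioi (0 : ℝ), zetaQuotientSystem p t * burnolYSystem 1 q t ≠ 0) :
    Burnol2004b_thm3_3 :=
  ⟨Burnol2004b_thm3_3_mem_of_prop4_2 h42, h63.2.1, h63.2.2, hoff, hlow, hdiag⟩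

end Literature.NumberTheory.LFunctions
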